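import Literature.AlgebraicGeometry.Motives.ComplexTorusIsogenyTransfer
import HarnessLib

/-!
# A homomorphism of complex abelian varieties of the same dimension that kills no torsion point is an isomorphism

Topic `AlgebraicGeometry/Motives`; namespace `Literature.AlgebraicGeometry.Motives.AbelianVariety` (helpers in the
sub-namespace `…AbelianVariety.IsoOfTorsionKernel`).
THEOREMS ONLY (no definition, no named fact, no instance, no `sorry`; net Literature debt 0).  Cell hodgecm-mathlib
(D-0151), #60 road, `B-plan/M1PRIME-DAG.md` §3 N6 row I1-i (ANNEX B §2 «the hypothesis of `IsModuli` makes
`f : σA ⟶ A′` an ISOMORPHISM … injective on torsion hence an isomorphism»), GENERIC CORE (a) per the DAG pen's routing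
word (B-plan1 g7, 2026-08-28T21:13:11Z); the marking-level assembly (b) over `SiegelAdelicMarking` consumes the head
`isIso_of_forall_torsionPoints_map_eq_one` below verbatim.

## The mathematics

Let `f : A ⟶ A′` be a homomorphism of abelian varieties over `ℂ` with `dim A = dim A′` such that NO non-trivial
torsion point of `A(ℂ)` is mapped to the origin (`hker`).  Then `f` is an isomorphism.  Printed anchors: over `ℂ` the
functor `A ↦ A(ℂ)` to compact complex Lie groups (complex tori) is fully faithful ([MumfordAV1970] §1 (3); [Lange 2023]
§2.1.4 «we can work either in the analytic or the algebraic category», Cor. 2.1.17), a homomorphism of tori is given by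
its rational representation on the lattices ([Lange2023AbelianVarietiesComplex] §1.1.2 Prop. 1.1.6, `ρ_r` injective;
[MumfordAV1970] §19 Thm. 3), and the `n`-torsion of `X = V/Λ` is `n⁻¹Λ/Λ` ([LangeBirkenhake1992] §1.1 Prop. 1.1.14).
PROOF (the tree's currency: ★ `HodgeTheory.complexAbelianVariety_torusUniformised_holds` uniformises `A`, `A′` by tori
`ℝ^ι/ℤ^ι`, `ℝ^{ι′}/ℤ^{ι′}` with complex structures `Φ`, `Φ′`; ★ `AbelianVariety.exists_mem_homInt_map_eq` reads `f` as an
INTEGER MATRIX `M ∈ Hom(X, X′) = homInt Φ Φ′` on lattice coordinates): a torsion point of `A(ℂ)` is `φ(π q)` with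
`q ∈ ℚ^ι`, and `f(φ(π q)) = φ′(π′(M q))`; hence `hker` says exactly «`q ∈ ℚ^ι`, `M q ∈ ℤ^{ι′}` ⇒ `q ∈ ℤ^ι`» (§3).  Such an
`M` has trivial rational kernel (if `M q = 0` then `M (c q) = 0 ∈ ℤ^{ι′}` for every `c ∈ ℚ`, so `c q ∈ ℤ^ι` for all `c`,
forcing `q = 0`), is square (`|ι| = 2 dim A = 2 dim A′ = |ι′|`, ★ `card_eq_two_mul_dim`), hence invertible over `ℚ`, and
the columns of `M⁻¹` pass the same test (`M (M⁻¹ e_j) = e_j ∈ ℤ^{ι′}`), so `M⁻¹` is an INTEGER matrix (§1).  The inverse of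
a matrix intertwining the complex structures intertwines them (§2), so `M⁻¹ ∈ Hom(X′, X)` and ★ `isoOfAnalytification`
exhibits the isomorphism `A ≅ A′` whose `hom` is (★ `eq_homOfMatrix_of_map_eq`) `f` itself (§4).

Consumers: the I1-i assembly of the Mumford line (B-p09: under the antecedent of ★ `SiegelRationalModel.IsModuli`,
`f : A.conjugate σ ⟶ A′` kills no torsion point, hence is an isomorphism — the «isomorphism of triples» reading of
[Milne2005ShimuraVarieties] §6 Thm. 6.11 p. 74 / §14 hypothesis of Prop. 14.12 p. 125).  Nothing printed is asserted as
a fact.  HC_CM is proved only modulo the 7 printed citations until rung 0 closes.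

## References
* [MumfordAV1970] D. Mumford, *Abelian Varieties* (1970), §1 (3), §19 Thm. 3.
* [Lange2023AbelianVarietiesComplex] H. Lange, *Abelian Varieties over the Complex Numbers* (2023), §1.1.2 Prop. 1.1.6
  (p. 9), §2.1.4 (p. 67) with Cor. 2.1.17.
* [LangeBirkenhake1992] H. Lange, Ch. Birkenhake, *Complex Abelian Varieties* (1992), §1.1 Prop. 1.1.14.
* [Milne2005ShimuraVarieties] J. S. Milne, *Introduction to Shimura varieties* (2005), §6 Thm. 6.11 p. 74.
-/

set_option autoImplicit false

noncomputable section

open CategoryTheory AlgebraicGeometry Matrix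

/-! ## §1 Integer matrices passing the integrality test `M q ∈ ℤ^{ι′} ⇒ q ∈ ℤ^ι` are invertible over `ℤ` -/

namespace Literature.AlgebraicGeometry.Motives.AbelianVariety.IsoOfTorsionKernel

/-- **Trivial rational kernel.**  If an integer matrix `M` passes the integrality test «`q ∈ ℚ^ι` and `M q ∈ ℤ^{ι′}` imply
`q ∈ ℤ^ι`» (`hT`), then `M q = 0` forces `q = 0`: otherwise `c q` with `c = (2 qᵢ)⁻¹` has `M (c q) = 0` integral but the
non-integral coordinate `1/2`. [cite: Lange2023AbelianVarietiesComplex, §1.1.2 Prop. 1.1.6 (ρ_r injective)] -/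
theorem eq_zero_of_mulVec_eq_zero {ι ι' : Type} [Fintype ι] (M : Matrix ι' ι ℤ)
    (hT : ∀ q : ι → ℚ, (∀ i', ∃ z : ℤ, ((M.map (Int.cast : ℤ → ℚ)) *ᵥ q) i' = z) → ∀ i, ∃ z : ℤ, q i = z)
    {q : ι → ℚ} (hq : (M.map (Int.cast : ℤ → ℚ)) *ᵥ q = 0) : q = 0 := by
  funext i
  rw [Pi.zero_apply]
  by_contra hi
  obtain ⟨w, hw⟩ := hT ((2 * q i)⁻¹ • q) (fun i' => ⟨0, by rw [mulVec_smul, hq]; simp⟩) i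
  have h2 : (2 : ℚ) * w = 1 := by
    rw [← hw, Pi.smul_apply, smul_eq_mul]
    field_simp
  have h2' : (2 : ℤ) * w = 1 := by exact_mod_cast h2
  omega

/-- **A square rational matrix with trivial kernel has a two-sided inverse** — here for index types of the same
cardinality (`|ι| = |ι′|`), through the reindexing `ι ≃ ι′` and Mathlib's `mulVec_injective_iff_isUnit`. [folklore] -/
private theorem exists_two_sided_inverse_rat {ι ι' : Type} [Fintype ι] [Fintype ι'] [DecidableEq ι] [DecidableEq ι']
    (Mq : Matrix ι' ι ℚ) (hcard : Fintype.card ι = Fintype.card ι') (hinj : ∀ q : ι → ℚ, Mq *ᵥ q = 0 → q = 0) :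
    ∃ Nq : Matrix ι ι' ℚ, Nq * Mq = 1 ∧ Mq * Nq = 1 := by
  obtain ⟨e⟩ : Nonempty (ι ≃ ι') := ⟨Fintype.equivOfCardEq hcard⟩
  obtain ⟨Msq, hMsq⟩ : ∃ Msq : Matrix ι' ι' ℚ, Msq = Mq.submatrix (Equiv.refl ι') e.symm := ⟨_, rfl⟩
  have hMq : Mq = Msq.submatrix (Equiv.refl ι') e := by
    ext i' i
    simp [hMsq]
  have hinjsq : Function.Injective Msq.mulVec := by
    intro v v' hvv'
    have h0 : Msq *ᵥ (v - v') = 0 := by rw [mulVec_sub, hvv', sub_self]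
    have h2 := submatrix_mulVec_equiv Mq (v - v') (Equiv.refl ι') e.symm
    rw [Equiv.symm_symm, ← hMsq, h0] at h2
    have h1 : Mq *ᵥ ((v - v') ∘ e) = 0 := by
      funext i'
      exact (congrFun h2 i').symm
    have h3 := hinj _ h1
    funext j
    have h4 := congrFun h3 (e.symm j)
    simp only [Function.comp_apply, Equiv.apply_symm_apply, Pi.sub_apply, Pi.zero_apply] at h4
    exact sub_eq_zero.1 h4
  have hunit : IsUnit Msq := mulVec_injective_iff_isUnit.1 hinjsq
  have hdet : IsUnit Msq.det := (isUnit_iff_isUnit_det Msq).1 hunit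
  refine ⟨(Msq⁻¹).submatrix e (Equiv.refl ι'), ?_, ?_⟩
  · rw [hMq, submatrix_mul_equiv, nonsing_inv_mul _ hdet, submatrix_one_equiv]
  · rw [hMq, submatrix_mul_equiv, mul_nonsing_inv _ hdet, submatrix_one_equiv]

/-- **The rational inverse of a matrix passing the integrality test is integral** (each column `M⁻¹ e_j` has
`M (M⁻¹ e_j) = e_j ∈ ℤ^{ι′}`), hence the matrix is invertible over `ℤ`. [folklore] -/
private theorem exists_int_inverse {ι ι' : Type} [Fintype ι] [Fintype ι'] [DecidableEq ι] [DecidableEq ι']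
    (M : Matrix ι' ι ℤ) (hcard : Fintype.card ι = Fintype.card ι')
    (hT : ∀ q : ι → ℚ, (∀ i', ∃ z : ℤ, ((M.map (Int.cast : ℤ → ℚ)) *ᵥ q) i' = z) → ∀ i, ∃ z : ℤ, q i = z) :
    ∃ N : Matrix ι ι' ℤ, N * M = 1 ∧ M * N = 1 := by
  obtain ⟨Nq, hNM, hMN⟩ := exists_two_sided_inverse_rat (M.map (Int.cast : ℤ → ℚ)) hcard
    (fun q hq => eq_zero_of_mulVec_eq_zero M hT hq)
  have hcol : ∀ i j', ∃ z : ℤ, Nq i j' = z := by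
    intro i j'
    refine hT (fun i => Nq i j') (fun i'' => ⟨if i'' = j' then 1 else 0, ?_⟩) i
    have h : ((M.map (Int.cast : ℤ → ℚ)) *ᵥ fun i => Nq i j') i'' = ((M.map (Int.cast : ℤ → ℚ)) * Nq) i'' j' := rfl
    rw [h, hMN, one_apply]
    split_ifs <;> simp
  choose Nz hNz using hcol
  have hmapN : (Matrix.of Nz).map (Int.cast : ℤ → ℚ) = Nq := by
    ext i j'
    simp [hNz]
  have hmul₁ : (Matrix.of Nz * M).map (Int.cast : ℤ → ℚ) =
      (Matrix.of Nz).map (Int.cast : ℤ → ℚ) * M.map (Int.cast : ℤ → ℚ) :=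
    Matrix.map_mul (f := Int.castRingHom ℚ)
  have hmul₂ : (M * Matrix.of Nz).map (Int.cast : ℤ → ℚ) =
      M.map (Int.cast : ℤ → ℚ) * (Matrix.of Nz).map (Int.cast : ℤ → ℚ) :=
    Matrix.map_mul (f := Int.castRingHom ℚ)
  refine ⟨Matrix.of Nz, ?_, ?_⟩
  · apply Matrix.map_injective (Int.cast_injective (α := ℚ))
    change (Matrix.of Nz * M).map (Int.cast : ℤ → ℚ) = (1 : Matrix ι ι ℤ).map (Int.cast : ℤ → ℚ)
    rw [hmul₁, hmapN, hNM, Matrix.map_one _ Int.cast_zero Int.cast_one]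
  · apply Matrix.map_injective (Int.cast_injective (α := ℚ))
    change (M * Matrix.of Nz).map (Int.cast : ℤ → ℚ) = (1 : Matrix ι' ι' ℤ).map (Int.cast : ℤ → ℚ)
    rw [hmul₂, hmapN, hMN, Matrix.map_one _ Int.cast_zero Int.cast_one]

/-! ## §2 Torus level: the inverse of an element of `Hom(X, X′)` lies in `Hom(X′, X)`; rational points of `π` -/

open Literature.Geometry.Kaehler

/-- `((N M) ⊗ ℚ) ⊗ ℝ = (N ⊗ ℝ)(M ⊗ ℝ)` for integer matrices (both casts are ring homomorphisms). [folklore] -/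
private theorem map_map_mul {ι κ ι' : Type} [Fintype κ] (N : Matrix ι κ ℤ) (M : Matrix κ ι' ℤ) :
    ((N * M).map (Int.cast : ℤ → ℚ)).map (Rat.cast : ℚ → ℝ) =
      (N.map (Int.cast : ℤ → ℚ)).map (Rat.cast : ℚ → ℝ) * (M.map (Int.cast : ℤ → ℚ)).map (Rat.cast : ℚ → ℝ) := by
  have h1 : (N * M).map (Int.cast : ℤ → ℚ) = N.map (Int.cast : ℤ → ℚ) * M.map (Int.cast : ℤ → ℚ) :=
    Matrix.map_mul (f := Int.castRingHom ℚ)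
  rw [h1]
  exact Matrix.map_mul (f := Rat.castHom ℝ)

/-- **`ρ_r(f)⁻¹ ∈ Hom(X′, X)`**: if the integer matrix `M ∈ Hom(X, X′) = homInt Φ Φ′` (its real extension intertwines
the complex structures `J`, `J′`) has a two-sided integer inverse `N`, then `N ∈ Hom(X′, X)` — `N J′ = N J′ M N =
N M J N = J N`. [cite: Lange2023AbelianVarietiesComplex, §1.1.2 Prop. 1.1.6] -/
theorem mem_homInt_of_inverse {ι ι' : Type} [Fintype ι] [Fintype ι'] [DecidableEq ι] [DecidableEq ι']
    {E E' : Type} [NormedAddCommGroup E] [NormedSpace ℂ E] [NormedAddCommGroup E'] [NormedSpace ℂ E']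
    (Φ : (ι → ℝ) ≃L[ℝ] E) (Φ' : (ι' → ℝ) ≃L[ℝ] E') {M : Matrix ι' ι ℤ} {N : Matrix ι ι' ℤ}
    (hM : M ∈ ComplexTorus.homInt Φ Φ') (hNM : N * M = 1) (hMN : M * N = 1) : N ∈ ComplexTorus.homInt Φ' Φ := by
  rw [ComplexTorus.mem_homInt_iff, ComplexTorus.mem_homRat_iff] at hM ⊢
  set Mr := (M.map (Int.cast : ℤ → ℚ)).map (Rat.cast : ℚ → ℝ) with hMr
  set Nr := (N.map (Int.cast : ℤ → ℚ)).map (Rat.cast : ℚ → ℝ) with hNr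
  have hNM' : Nr * Mr = 1 := by
    rw [hMr, hNr, ← map_map_mul, hNM, Matrix.map_one _ Int.cast_zero Int.cast_one,
      Matrix.map_one _ Rat.cast_zero Rat.cast_one]
  have hMN' : Mr * Nr = 1 := by
    rw [hMr, hNr, ← map_map_mul, hMN, Matrix.map_one _ Int.cast_zero Int.cast_one,
      Matrix.map_one _ Rat.cast_zero Rat.cast_one]
  calc Nr * ComplexTorus.jMatrix Φ' = Nr * ComplexTorus.jMatrix Φ' * (Mr * Nr) := by rw [hMN', Matrix.mul_one]
    _ = Nr * (ComplexTorus.jMatrix Φ' * Mr) * Nr := by simp only [Matrix.mul_assoc]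
    _ = Nr * (Mr * ComplexTorus.jMatrix Φ) * Nr := by rw [← hM]
    _ = (Nr * Mr) * ComplexTorus.jMatrix Φ * Nr := by simp only [Matrix.mul_assoc]
    _ = ComplexTorus.jMatrix Φ * Nr := by rw [hNM', Matrix.one_mul]

/-- **Rational points of the covering map**: `π(q) = 0` for a RATIONAL vector `q` iff `q ∈ ℤ^ι`
(coordinatewise `ℝ/ℤ`). [cite: LangeBirkenhake1992, §1.1 Prop. 1.1.14] -/
theorem proj_ratCast_eq_zero_iff {ι : Type} {E : Type} [NormedAddCommGroup E] [NormedSpace ℂ E]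
    (Φ : (ι → ℝ) ≃L[ℝ] E) (q : ι → ℚ) :
    ComplexTorus.proj Φ (fun i => ((q i : ℚ) : ℝ)) = 0 ↔ ∀ i, ∃ z : ℤ, q i = z := by
  constructor
  · intro h i
    have hi : (((q i : ℚ) : ℝ) : AddCircle (1 : ℝ)) = 0 := congrFun h i
    rw [AddCircle.coe_eq_zero_iff] at hi
    obtain ⟨n, hn⟩ := hi
    refine ⟨n, ?_⟩
    rw [zsmul_eq_mul, mul_one] at hn
    exact_mod_cast hn.symm
  · intro h
    funext i
    obtain ⟨z, hz⟩ := h i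
    change (((q i : ℚ) : ℝ) : AddCircle (1 : ℝ)) = 0
    rw [AddCircle.coe_eq_zero_iff]
    exact ⟨z, by rw [zsmul_eq_mul, mul_one, hz, Rat.cast_intCast]⟩

/-- `π(n • x) = n • π(x)`. [folklore] -/
private theorem proj_nsmul {ι : Type} {E : Type} [NormedAddCommGroup E] [NormedSpace ℂ E] (Φ : (ι → ℝ) ≃L[ℝ] E)
    (n : ℕ) (x : ι → ℝ) : ComplexTorus.proj Φ (n • x) = n • ComplexTorus.proj Φ x := by
  induction n with
  | zero =>
    rw [zero_smul, zero_smul]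
    funext i
    rfl
  | succ n ih => rw [succ_nsmul, succ_nsmul, ComplexTorus.proj_add, ih]

/-- The real extension of an integer matrix on a rational vector is the rational image, cast:
`M_ℝ q_ℝ = (M_ℚ q)_ℝ`. [folklore] -/
private theorem map_intCast_real_mulVec_ratCast {ι ι' : Type} [Fintype ι] (M : Matrix ι' ι ℤ) (q : ι → ℚ) :
    (M.map (Int.cast : ℤ → ℝ)) *ᵥ (fun i => ((q i : ℚ) : ℝ)) =
      fun i' => ((((M.map (Int.cast : ℤ → ℚ)) *ᵥ q) i' : ℚ) : ℝ) := by
  funext i'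
  simp only [mulVec, dotProduct, map_apply, Rat.cast_sum, Rat.cast_mul, Rat.cast_intCast]

/-! ## §3 The kernel hypothesis on lattice coordinates -/

open Literature.NumberTheory.Transcendental

/-- An additive uniformisation maps `0` to the origin `1 ∈ A(ℂ)`. [folklore] -/
private theorem map_zero_eq_one {ι : Type} {E : Type} [NormedAddCommGroup E] [NormedSpace ℂ E] {Φ : (ι → ℝ) ≃L[ℝ] E}
    {A : AbelianVariety ℂ} {φ : ComplexTorus Φ → ComplexPoints A.X}
    (hadd : ∀ x y : ComplexTorus Φ, φ (x + y) = φ x * φ y) : φ 0 = 1 := by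
  have h := hadd 0 0
  rw [add_zero] at h
  exact mul_left_cancel (h.symm.trans (mul_one _).symm)

/-- `φ(n • x) = φ(x)ⁿ` for an additive uniformisation. [folklore] -/
private theorem map_nsmul_eq_pow {ι : Type} {E : Type} [NormedAddCommGroup E] [NormedSpace ℂ E] {Φ : (ι → ℝ) ≃L[ℝ] E}
    {A : AbelianVariety ℂ} {φ : ComplexTorus Φ → ComplexPoints A.X}
    (hadd : ∀ x y : ComplexTorus Φ, φ (x + y) = φ x * φ y) (n : ℕ) (x : ComplexTorus Φ) :
    φ (n • x) = φ x ^ n := by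
  induction n with
  | zero => rw [zero_smul, pow_zero, map_zero_eq_one hadd]
  | succ n ih => rw [succ_nsmul, hadd, ih, pow_succ]

/-- **Common denominator**: a rational vector `q ∈ ℚ^ι` has `d q ∈ ℤ^ι` for some integer `d ≥ 1` (the product of the
denominators). [folklore] -/
private theorem exists_nsmul_int {ι : Type} [Fintype ι] (q : ι → ℚ) : ∃ d : ℕ, d ≠ 0 ∧ ∀ i, ∃ z : ℤ, (d : ℚ) * q i = z := by
  refine ⟨∏ i, (q i).den, Finset.prod_ne_zero_iff.2 fun i _ => (q i).den_pos.ne', fun i => ?_⟩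
  have hdvd : (q i).den ∣ ∏ j, (q j).den := Finset.dvd_prod_of_mem _ (Finset.mem_univ i)
  obtain ⟨c, hc⟩ := hdvd
  refine ⟨c * (q i).num, ?_⟩
  rw [hc]
  push_cast
  rw [mul_comm ((q i).den : ℚ) (c : ℚ), mul_assoc, mul_comm ((q i).den : ℚ) (q i), Rat.mul_den_eq_num]

/-- **The kernel hypothesis read on lattice coordinates.**  If `φ : X → A(ℂ)`, `φ′ : X′ → A′(ℂ)` are additive
analytifications by the tori `X = ℝ^ι/ℤ^ι`, `X′ = ℝ^{ι′}/ℤ^{ι′}`, the integer matrix `M` induces `f` (`hu`: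
`φ′(M · x) = f(φ x)`), and `f` kills no non-trivial torsion point of `A(ℂ)` (`hker`), then `M` passes the integrality
test: for `q ∈ ℚ^ι`, `M q ∈ ℤ^{ι′}` implies `q ∈ ℤ^ι`.  Indeed `P = φ(π q)` is torsion (`d q ∈ ℤ^ι` ⇒ `P^d = 1`),
`f(P) = φ′(π′(M q)) = φ′(0) = 1`, so `P = 1`, `π q = 0`, `q ∈ ℤ^ι`.
[cite: LangeBirkenhake1992, §1.1 Prop. 1.1.14 (torsion of a complex torus)] [cite: Lange2023AbelianVarietiesComplex, §1.1.2 Prop. 1.1.6] -/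
theorem forall_int_of_mulVec_int {ι : Type} [Fintype ι] {E : Type} [NormedAddCommGroup E] [NormedSpace ℂ E]
    [FiniteDimensional ℂ E] {Φ : (ι → ℝ) ≃L[ℝ] E}
    {ι' : Type} {E' : Type} [NormedAddCommGroup E'] [NormedSpace ℂ E'] {Φ' : (ι' → ℝ) ≃L[ℝ] E'}
    {A A' : AbelianVariety ℂ} {φ : ComplexTorus Φ → ComplexPoints A.X} {φ' : ComplexTorus Φ' → ComplexPoints A'.X}
    (hφ : IsAnalytification E A.X A.dim φ)
    (hadd : ∀ x y : ComplexTorus Φ, φ (x + y) = φ x * φ y)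
    (hadd' : ∀ x y : ComplexTorus Φ', φ' (x + y) = φ' x * φ' y) {f : A ⟶ A'} {M : Matrix ι' ι ℤ}
    (hu : ∀ x, φ' (ComplexTorus.mapMatrix Φ Φ' M x) = AlgPoints.map f.hom.hom.hom (φ x))
    (hker : ∀ N : ℤ, N ≠ 0 → ∀ P ∈ A.torsionPoints ℂ N, AlgPoints.map f.hom.hom.hom P = 1 → P = 1)
    (q : ι → ℚ) (hq : ∀ i', ∃ z : ℤ, ((M.map (Int.cast : ℤ → ℚ)) *ᵥ q) i' = z) : ∀ i, ∃ z : ℤ, q i = z := by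
  -- the point `P = φ (π q)` and its order
  obtain ⟨d, hd, hdq⟩ := exists_nsmul_int q
  have hdx : ComplexTorus.proj Φ (d • fun i => ((q i : ℚ) : ℝ)) = 0 := by
    have h1 : (d • fun i => ((q i : ℚ) : ℝ)) = fun i => ((((d : ℚ) * q i : ℚ)) : ℝ) := by
      funext i
      rw [Pi.smul_apply, nsmul_eq_mul, Rat.cast_mul, Rat.cast_natCast]
    rw [h1, proj_ratCast_eq_zero_iff]
    exact hdq
  have hP : φ (ComplexTorus.proj Φ fun i => ((q i : ℚ) : ℝ)) ∈ A.torsionPoints ℂ (d : ℤ) := by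
    rw [mem_torsionPoints_iff, zpow_natCast, ← map_nsmul_eq_pow hadd,
      ← proj_nsmul, hdx, map_zero_eq_one hadd]
  -- `f P = 1`
  have hfP : AlgPoints.map f.hom.hom.hom (φ (ComplexTorus.proj Φ fun i => ((q i : ℚ) : ℝ))) = 1 := by
    rw [← hu, ComplexTorus.mapMatrix_proj, map_intCast_real_mulVec_ratCast,
      (proj_ratCast_eq_zero_iff Φ' _).2 hq, map_zero_eq_one hadd']
  -- hence `P = 1`, `π q = 0`, `q` integral
  have hP1 := hker (d : ℤ) (by exact_mod_cast hd) _ hP hfP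
  rw [← map_zero_eq_one hadd] at hP1
  exact (proj_ratCast_eq_zero_iff Φ q).1 (hφ.isHomeomorph.bijective.1 hP1)

end Literature.AlgebraicGeometry.Motives.AbelianVariety.IsoOfTorsionKernel

/-! ## §4 The theorem -/

namespace Literature.AlgebraicGeometry.Motives.AbelianVariety

open Literature.NumberTheory.Transcendental Literature.Geometry.Kaehler

/-- **A homomorphism of complex abelian varieties of the same dimension that maps no non-trivial torsion point to the
origin is an isomorphism** ([MumfordAV1970] §1 (3): `A ↦ A(ℂ)` is fully faithful into complex tori, §19 Thm. 3: the
rational representation is faithful; [Lange2023AbelianVarietiesComplex] §1.1.2 Prop. 1.1.6, §2.1.4 Cor. 2.1.17).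
For `f : A ⟶ A′` with `dim A = dim A′` (`hdim`) and «`P ∈ A(ℂ)[N]`, `N ≠ 0`, `f(P) = 1` ⇒ `P = 1`» (`hker`): `IsIso f`.
Proof: uniformise (★ `complexAbelianVariety_torusUniformised_holds`), read `f` as an integer matrix `M ∈ Hom(X, X′)`
(★ `exists_mem_homInt_map_eq`); `hker` becomes the integrality test `M q ∈ ℤ^{ι′} ⇒ q ∈ ℤ^ι` on `ℚ^ι`
(`forall_int_of_mulVec_int`), which with `|ι| = 2 dim A = 2 dim A′ = |ι′|` (★ `card_eq_two_mul_dim`) makes `M`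
invertible over `ℤ` (`exists_int_inverse`); `M⁻¹ ∈ Hom(X′, X)` (`mem_homInt_of_inverse`), and ★ `isoOfAnalytification`
is an isomorphism `A ≅ A′` whose `hom` is `f` (★ `eq_homOfMatrix_of_map_eq`).  The GENERIC CORE (a) of M1PRIME-DAG
§3 N6 row I1-i; the marking-level statement (b) instantiates it at `f : A.conjugate σ ⟶ A′` under the antecedent of
★ `SiegelRationalModel.IsModuli` ([Milne2005ShimuraVarieties] §6 Thm. 6.11: «an isomorphism of triples»).
[cite: MumfordAV1970, §1 (3) and §19 Thm. 3] [cite: Lange2023AbelianVarietiesComplex, §1.1.2 Prop. 1.1.6 (p. 9) and §2.1.4 Cor. 2.1.17 (p. 67)]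
[cite: Milne2005ShimuraVarieties, §6 Thm. 6.11 p. 74] -/
theorem isIso_of_forall_torsionPoints_map_eq_one {A A' : AbelianVariety ℂ} (f : A ⟶ A')
    (hdim : A.dim = A'.dim)
    (hker : ∀ N : ℤ, N ≠ 0 → ∀ P ∈ A.torsionPoints ℂ N, AlgPoints.map f.hom.hom.hom P = 1 → P = 1) :
    IsIso f := by
  obtain ⟨ι, _, _, Φ, φ, hφ, hadd⟩ :=
    Literature.AlgebraicGeometry.HodgeTheory.complexAbelianVariety_torusUniformised_holds A
  obtain ⟨ι', _, _, Φ', φ', hφ', hadd'⟩ :=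
    Literature.AlgebraicGeometry.HodgeTheory.complexAbelianVariety_torusUniformised_holds A'
  have hφ0 : φ 0 = 1 := IsoOfTorsionKernel.map_zero_eq_one hadd
  have hφ'0 : φ' 0 = 1 := IsoOfTorsionKernel.map_zero_eq_one hadd'
  obtain ⟨M, hM, hu⟩ := exists_mem_homInt_map_eq hφ hφ' hφ0 hφ'0 f
  have hcard : Fintype.card ι = Fintype.card ι' := by
    rw [card_eq_two_mul_dim hφ, card_eq_two_mul_dim hφ', hdim]
  obtain ⟨N, hNM, hMN⟩ := IsoOfTorsionKernel.exists_int_inverse M hcard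
    (IsoOfTorsionKernel.forall_int_of_mulVec_int hφ hadd hadd' hu hker)
  have hN : N ∈ ComplexTorus.homInt Φ' Φ := IsoOfTorsionKernel.mem_homInt_of_inverse Φ Φ' hM hNM hMN
  have hf : f = homOfMatrix hφ hφ' hφ0 hφ'0 M hM := eq_homOfMatrix_of_map_eq hφ hφ' hφ0 hφ'0 hM hu
  have he : (isoOfAnalytification hφ hφ' hadd hadd' ⟨M, hM⟩ ⟨N, hN⟩ hNM hMN).hom =
      homOfMatrix hφ hφ' hφ0 hφ'0 M hM := rfl
  rw [hf, ← he]
  infer_instance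

end Literature.AlgebraicGeometry.Motives.AbelianVariety

end
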